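import Literature.Analysis.FluidPDE.NormalisedPressureL2Bound
import Literature.Analysis.FluidPDE.BiotSavartBounds
import Literature.Analysis.FluidPDE.WholeSpaceIBP
import HarnessLib

/-!
# The Biot–Savart integral of an `L¹ ∩ L^∞` vorticity: convergence, bounds, continuity, decay,
symmetry

Analysis/FluidPDE support file (all results proved, no definitions) on the decomposition path of
the named fact `Literature.Analysis.FluidPDE.biotSavart_curl_eq_self` (`Vorticity.lean`: a `C¹`
divergence-free field on `ℝ³` vanishing at infinity whose curl is integrable and bounded is the
Biot–Savart velocity of its curl, `u = K₃ * curl u`; Majda–Bertozzi, *Vorticity and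
Incompressible Flow*, §2.4.1, Prop. 2.16 and (2.94)–(2.95)), itself a brick of
`Literature.Analysis.FluidPDE.MajdaBertozzi2002_holderEulerUniqueness`
(`ElgindiAprioriBlowupProofs.lean`). Here: the elementary real analysis of the Biot–Savart
integral `(K₃ * ω)(x) = ∫ K(x − y) ω(y) dy` (the tree's `biotSavart`, kernel
`biotSavartKernel z h = (4π‖z‖³)⁻¹ • (h × z)`) for a vorticity `ω ∈ L¹ ∩ L^∞` (continuous where
continuity is concluded):

* measurability of the kernel (its size `‖K(z) h‖ ≤ ‖h‖/(4π‖z‖²)` is the tree's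
  `norm_biotSavartKernel_le`, `BiotSavartBounds.lean`); the radial majorant
  `‖K(z) h‖ ≤ (4π)⁻¹ (C 1_{‖z‖<ρ}‖z‖⁻² + ρ⁻²‖h‖)` for `‖h‖ ≤ C`
  (`norm_biotSavartKernel_le_nearProfile`; the tree's `nearProfile₂`, `∫ 1_{‖z‖<ρ}‖z‖⁻² = 4πρ`);
* `integrable_biotSavartKernel_sub_apply`: **the integral converges absolutely** at every `x`;
  `norm_biotSavart_le`: `‖K₃ * ω‖_∞ ≤ C + (4π)⁻¹‖ω‖_{L¹}`;
* `biotSavart_eq_near_add_far`: the smooth near/far splitting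
  `K = χ_δ K + (1 − χ_δ) K` with the tree's radial cutoff `cutoff δ` (`WholeSpaceIBP`), the near
  part bounded by `2Cδ` uniformly (`norm_integral_near_le`), the far integrand by
  `(4πδ²)⁻¹ ‖ω(y)‖` (`norm_one_sub_cutoff_smul_biotSavartKernel_le`);
* `continuous_biotSavart`: **`K₃ * ω` is continuous** for continuous `ω ∈ L¹ ∩ L^∞` (dominated
  convergence on both parts; the far kernel `(1 − χ_δ)K` is continuous everywhere);
* `tendsto_biotSavart_cocompact`: **`K₃ * ω → 0` at infinity** (near part `≤ 2Cδ`, far part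
  `→ 0` by dominated convergence along the cocompact filter, which is `comap ‖·‖ atTop`);
* `integral_inner_biotSavart_eq`: **symmetry** `∫ ⟪K₃ * ω, Φ⟫ = ∫ ⟪ω, K₃ * Φ⟫` for continuous
  compactly supported `Φ` (Fubini; pointwise `⟪K(z)a, b⟫ = ⟪a, K(−z)b⟫`,
  `inner_biotSavartKernel_left`) — the device by which the weak divergence and weak curl of
  `K₃ * ω` are computed for a merely continuous `ω` in the sequel.

Majda–Bertozzi prove Prop. 2.16 for smooth rapidly decaying `ω` ("`v` … is not in `L²`, in
general, but it still vanishes as `|x| ↗ ∞`", p. 64 of the held text; "in three dimensions `K₃`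
decays like `1/r²`", p. 80); the statements here are the `L¹ ∩ L^∞` versions needed for the
named fact as vendored.

## Mathlib / tree search

Mathlib has no Biot–Savart law (`lean search 'biotSavart'`: `Vorticity.lean`, `NSVorticity.lean`,
`BiotSavartBounds.lean` — Majda–Bertozzi Lemma 4.5 for vorticities supported in a ball, whose
kernel bound is reused — and the *local* Biot–Savart files of the Tao 2013 decomposition). Used
from the tree: `biotSavart`, `biotSavartKernel`, `cross`, `crossCLM` (`VectorCalculus`,
`Vorticity`); `norm_biotSavartKernel_le` (`BiotSavartBounds`); `nearProfile₂`,
`integrable_nearProfile₂_norm`, `integral_nearProfile₂_norm_eq` (`TaoEnergyLocalisationPressure`,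
`NormalisedPressureL2Bound`); `cutoff` and its API
(`WholeSpaceIBP`). From Mathlib: `continuous_of_dominated`,
`tendsto_integral_filter_of_dominated_convergence`, `integrable_prod_iff`,
`integral_integral_swap`, `integral_inner`, `tendsto_dist_right_cocompact_atTop`,
`comap_norm_atTop`, `Metric.cobounded_eq_cocompact`.

## References

* A. J. Majda, A. L. Bertozzi, *Vorticity and Incompressible Flow* (CUP 2002), §2.4.1,
  Prop. 2.16, eqs. (2.94)–(2.95) (p. 63–64 of the held text); §3.1.3 (p. 80).
  [MajdaBertozziCUP2002]
-/

noncomputable section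

open MeasureTheory Set Filter Topology Function Metric InnerProductSpace
open scoped ENNReal NNReal RealInnerProductSpace

namespace Literature.Analysis.FluidPDE

/-! ### The kernel: algebra, size, measurability -/

/-- The Biot–Savart kernel as the bilinear map `crossCLM`: `K(z) h = (4π‖z‖³)⁻¹ • (h × z)`. [folklore] -/
theorem biotSavartKernel_eq_smul_crossCLM (z h : (EuclideanSpace ℝ (Fin 3))) :
    biotSavartKernel z h = (4 * Real.pi * ‖z‖ ^ 3)⁻¹ • crossCLM h z := rfl

/-- Size of the kernel in the form used below, `‖K(z) h‖ ≤ ‖h‖/(4π‖z‖²)` (the tree's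
`norm_biotSavartKernel_le`, `BiotSavartBounds.lean`, rearranged). [folklore] -/
private theorem norm_biotSavartKernel_le' (z h : (EuclideanSpace ℝ (Fin 3))) :
    ‖biotSavartKernel z h‖ ≤ (4 * Real.pi * ‖z‖ ^ 2)⁻¹ * ‖h‖ := by
  have h1 := norm_biotSavartKernel_le z h
  have e : (4 * Real.pi)⁻¹ * ‖h‖ * (‖z‖ ^ 2)⁻¹ = (4 * Real.pi * ‖z‖ ^ 2)⁻¹ * ‖h‖ := by
    rw [mul_inv]
    ring
  rwa [e] at h1

/-- The Biot–Savart kernel is jointly measurable in `(z, h)`. [folklore] -/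
theorem measurable_biotSavartKernel :
    Measurable fun p : (EuclideanSpace ℝ (Fin 3)) × (EuclideanSpace ℝ (Fin 3)) => biotSavartKernel p.1 p.2 := by
  have h1 : Measurable fun p : (EuclideanSpace ℝ (Fin 3)) × (EuclideanSpace ℝ (Fin 3)) => (4 * Real.pi * ‖p.1‖ ^ 3)⁻¹ :=
    ((measurable_const.mul (measurable_fst.norm.pow_const 3)).inv)
  have h2 : Continuous fun p : (EuclideanSpace ℝ (Fin 3)) × (EuclideanSpace ℝ (Fin 3)) => crossCLM p.2 p.1 :=
    crossCLM.continuous₂.comp (continuous_snd.prodMk continuous_fst)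
  have e : (fun p : (EuclideanSpace ℝ (Fin 3)) × (EuclideanSpace ℝ (Fin 3)) => biotSavartKernel p.1 p.2) =
      fun p => (4 * Real.pi * ‖p.1‖ ^ 3)⁻¹ • crossCLM p.2 p.1 :=
    funext fun p => biotSavartKernel_eq_smul_crossCLM p.1 p.2
  rw [e]
  exact Measurable.smul h1 h2.measurable

/-- Measurability of the Biot–Savart integrand `y ↦ K(x − y) ω(y)` for measurable `ω`. [folklore] -/
theorem measurable_biotSavartKernel_sub_apply {ω : (EuclideanSpace ℝ (Fin 3)) → (EuclideanSpace ℝ (Fin 3))} (hω : Measurable ω) (x : (EuclideanSpace ℝ (Fin 3))) :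
    Measurable fun y => biotSavartKernel (x - y) (ω y) := by
  have h1 : Measurable fun y : (EuclideanSpace ℝ (Fin 3)) => x - y := (continuous_const.sub continuous_id).measurable
  have h : Measurable fun y : (EuclideanSpace ℝ (Fin 3)) => (x - y, ω y) := h1.prodMk hω
  -- `have` first: unifying `Measurable.comp` directly against the goal unfolds the kernel
  have h2 := Measurable.comp measurable_biotSavartKernel h
  exact h2

/-- **The radial majorant.** For `‖h‖ ≤ C` and any `ρ > 0`:
`‖K(z) h‖ ≤ (4π)⁻¹ (C · 1_{‖z‖<ρ} ‖z‖⁻² + ρ⁻² ‖h‖)` — the locally integrable singularity near the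
origin plus a bounded tail. [folklore] -/
theorem norm_biotSavartKernel_le_nearProfile {z h : (EuclideanSpace ℝ (Fin 3))} {C ρ : ℝ} (hh : ‖h‖ ≤ C) (hρ : 0 < ρ) :
    ‖biotSavartKernel z h‖ ≤
      (4 * Real.pi)⁻¹ * (C * nearProfile₂ ρ ‖z‖ + (ρ ^ 2)⁻¹ * ‖h‖) := by
  have hC : 0 ≤ C := (norm_nonneg _).trans hh
  refine (norm_biotSavartKernel_le' z h).trans ?_
  rcases eq_or_ne z 0 with rfl | hz
  · simp only [norm_zero, ne_eq, OfNat.ofNat_ne_zero, not_false_eq_true, zero_pow, mul_zero,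
      inv_zero, zero_mul]
    have : 0 ≤ nearProfile₂ ρ 0 := nearProfile₂_nonneg _ _
    positivity
  have hz' : 0 < ‖z‖ := norm_pos_iff.2 hz
  unfold nearProfile₂
  by_cases hlt : ‖z‖ < ρ
  · rw [if_pos hlt]
    have h1 : (4 * Real.pi * ‖z‖ ^ 2)⁻¹ * ‖h‖ ≤ (4 * Real.pi)⁻¹ * (C * (‖z‖ ^ 2)⁻¹) := by
      rw [mul_inv, mul_assoc]
      refine mul_le_mul_of_nonneg_left ?_ (by positivity)
      rw [mul_comm]
      exact mul_le_mul_of_nonneg_right hh (by positivity)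
    refine h1.trans ?_
    have : 0 ≤ (ρ ^ 2)⁻¹ * ‖h‖ := by positivity
    exact mul_le_mul_of_nonneg_left (le_add_of_nonneg_right this) (by positivity)
  · rw [if_neg hlt, mul_zero, zero_add]
    rw [not_lt] at hlt
    have h1 : (4 * Real.pi * ‖z‖ ^ 2)⁻¹ ≤ (4 * Real.pi)⁻¹ * (ρ ^ 2)⁻¹ := by
      rw [mul_inv]
      refine mul_le_mul_of_nonneg_left ?_ (by positivity)
      exact inv_anti₀ (by positivity) (pow_le_pow_left₀ hρ.le hlt 2)
    calc (4 * Real.pi * ‖z‖ ^ 2)⁻¹ * ‖h‖ ≤ (4 * Real.pi)⁻¹ * (ρ ^ 2)⁻¹ * ‖h‖ :=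
          mul_le_mul_of_nonneg_right h1 (norm_nonneg _)
      _ = (4 * Real.pi)⁻¹ * ((ρ ^ 2)⁻¹ * ‖h‖) := by ring

/-! ### Convergence of the Biot–Savart integral and the sup bound -/

section Bounds

variable {ω : (EuclideanSpace ℝ (Fin 3)) → (EuclideanSpace ℝ (Fin 3))} {C : ℝ}

/-- The radial majorant `y ↦ (4π)⁻¹ (C · 1_{‖x−y‖<ρ} ‖x−y‖⁻² + ρ⁻² ‖ω y‖)` of the Biot–Savart
integrand is integrable for `ω ∈ L¹`. [folklore] -/
theorem integrable_biotSavart_majorant (hωi : Integrable ω) (C : ℝ) {ρ : ℝ} (hρ : 0 < ρ) (x : (EuclideanSpace ℝ (Fin 3))) :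
    Integrable fun y => (4 * Real.pi)⁻¹ * (C * nearProfile₂ ρ ‖x - y‖ + (ρ ^ 2)⁻¹ * ‖ω y‖) :=
  ((((integrable_nearProfile₂_norm hρ).comp_sub_left x).const_mul C).add
    (hωi.norm.const_mul _)).const_mul _

/-- **The Biot–Savart integral converges absolutely** for a measurable vorticity `ω ∈ L¹ ∩ L^∞`:
`y ↦ K(x − y) ω(y)` is integrable for every `x` (Majda–Bertozzi, §2.4.1: the kernel is locally
integrable, `|K₃(x)| ≤ c|x|⁻²`, and bounded away from the origin). [folklore] -/
theorem integrable_biotSavartKernel_sub_apply (hωm : Measurable ω) (hωi : Integrable ω)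
    (hωb : ∀ y, ‖ω y‖ ≤ C) (x : (EuclideanSpace ℝ (Fin 3))) :
    Integrable fun y => biotSavartKernel (x - y) (ω y) :=
  (integrable_biotSavart_majorant hωi C one_pos x).mono'
    (measurable_biotSavartKernel_sub_apply hωm x).aestronglyMeasurable
    (Eventually.of_forall fun y => by
      simpa using norm_biotSavartKernel_le_nearProfile (z := x - y) (hωb y) one_pos)

/-- **`L¹` bound on the integrand**: `∫ ‖K(x − y) ω(y)‖ dy ≤ C + (4π)⁻¹ ‖ω‖_{L¹}` for `‖ω‖ ≤ C`,
`ω ∈ L¹` (`∫ 1_{‖z‖<1} ‖z‖⁻² dz = 4π`). [folklore] -/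
theorem integral_norm_biotSavartKernel_sub_apply_le (hωi : Integrable ω) (hωb : ∀ y, ‖ω y‖ ≤ C)
    (x : (EuclideanSpace ℝ (Fin 3))) : ∫ y, ‖biotSavartKernel (x - y) (ω y)‖ ≤ C + (4 * Real.pi)⁻¹ * ∫ y, ‖ω y‖ := by
  have hC : 0 ≤ C := (norm_nonneg _).trans (hωb x)
  have h := integral_mono_of_nonneg (Eventually.of_forall fun y => norm_nonneg _)
    (integrable_biotSavart_majorant hωi C one_pos x)
    (Eventually.of_forall fun y => by
      simpa using norm_biotSavartKernel_le_nearProfile (z := x - y) (hωb y) one_pos)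
  refine h.trans (le_of_eq ?_)
  rw [integral_const_mul, integral_add (((integrable_nearProfile₂_norm one_pos).comp_sub_left
      x).const_mul C) (hωi.norm.const_mul _), integral_const_mul, integral_const_mul,
    integral_sub_left_eq_self (fun z : (EuclideanSpace ℝ (Fin 3)) => nearProfile₂ 1 ‖z‖) volume x,
    integral_nearProfile₂_norm_eq one_pos]
  field_simp

/-- **Sup bound**: `‖(K₃ * ω)(x)‖ ≤ C + (4π)⁻¹ ‖ω‖_{L¹}` for `‖ω‖ ≤ C`, `ω ∈ L¹`. [folklore] -/
theorem norm_biotSavart_le (hωi : Integrable ω) (hωb : ∀ y, ‖ω y‖ ≤ C) (x : (EuclideanSpace ℝ (Fin 3))) :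
    ‖biotSavart ω x‖ ≤ C + (4 * Real.pi)⁻¹ * ∫ y, ‖ω y‖ :=
  (norm_integral_le_integral_norm _).trans (integral_norm_biotSavartKernel_sub_apply_le hωi hωb x)

end Bounds


/-! ### The smooth near/far splitting of the kernel -/

section Split

variable {ω : (EuclideanSpace ℝ (Fin 3)) → (EuclideanSpace ℝ (Fin 3))} {C : ℝ}

/-- The kernel is continuous in `h` for fixed `z` (it is linear in `h`). [folklore] -/
theorem continuous_biotSavartKernel_right (z : (EuclideanSpace ℝ (Fin 3))) : Continuous fun h => biotSavartKernel z h := by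
  have : (fun h => biotSavartKernel z h) = fun h => (4 * Real.pi * ‖z‖ ^ 3)⁻¹ • crossCLM.flip z h :=
    funext fun h => biotSavartKernel_eq_smul_crossCLM z h
  rw [this]
  exact (crossCLM.flip z).continuous.const_smul ((4 * Real.pi * ‖z‖ ^ 3)⁻¹ : ℝ)

/-- The kernel is continuous in `z` away from the origin. [folklore] -/
theorem continuousAt_biotSavartKernel_left {z : (EuclideanSpace ℝ (Fin 3))} (hz : z ≠ 0) (h : (EuclideanSpace ℝ (Fin 3))) :
    ContinuousAt (fun z => biotSavartKernel z h) z := by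
  have e : (fun z => biotSavartKernel z h) = fun z => (4 * Real.pi * ‖z‖ ^ 3)⁻¹ • crossCLM h z :=
    funext fun z => biotSavartKernel_eq_smul_crossCLM z h
  rw [e]
  have h1 : ContinuousAt (fun z : (EuclideanSpace ℝ (Fin 3)) => (4 * Real.pi * ‖z‖ ^ 3)⁻¹) z :=
    ((continuous_const.mul (continuous_norm.pow 3)).continuousAt).inv₀
      (by
        have h0 : 0 < ‖z‖ := norm_pos_iff.2 hz
        show 4 * Real.pi * ‖z‖ ^ 3 ≠ 0
        positivity)
  exact h1.smul (crossCLM h).continuous.continuousAt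

/-- **The far kernel `(1 − χ_δ) K` is continuous everywhere**: it vanishes on the ball `‖z‖ ≤ δ`
around the singularity and is a product of continuous functions elsewhere. [folklore] -/
theorem continuous_one_sub_cutoff_smul_biotSavartKernel {δ : ℝ} (hδ : 0 < δ) (h : (EuclideanSpace ℝ (Fin 3))) :
    Continuous fun z => (1 - cutoff δ z) • biotSavartKernel z h := by
  refine continuous_iff_continuousAt.2 fun z => ?_
  rcases eq_or_ne z 0 with rfl | hz
  · -- identically zero on the ball of radius `δ`
    have hev : (fun z => (1 - cutoff δ z) • biotSavartKernel z h) =ᶠ[𝓝 (0 : (EuclideanSpace ℝ (Fin 3)))] fun _ => 0 := by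
      filter_upwards [Metric.ball_mem_nhds (0 : (EuclideanSpace ℝ (Fin 3))) hδ] with w hw
      rw [cutoff_eq_one hδ (mem_ball_zero_iff.1 hw).le, sub_self, zero_smul]
    exact (continuousAt_const.congr hev.symm)
  · exact ((continuous_const.sub (contDiff_cutoff (n := 0) δ).continuous).continuousAt).smul
      (continuousAt_biotSavartKernel_left hz h)

/-- **Near/far splitting of the Biot–Savart integral** at scale `δ > 0`:
`(K * ω)(x) = ∫ χ_δ(z) K(z) ω(x − z) dz + ∫ (1 − χ_δ(x − y)) K(x − y) ω(y) dy`, with the smooth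
radial cutoff `χ_δ = cutoff δ` (`= 1` on `‖z‖ ≤ δ`, `= 0` on `‖z‖ ≥ 2δ`). [folklore] -/
theorem biotSavart_eq_near_add_far (hωm : Measurable ω) (hωi : Integrable ω) (hωb : ∀ y, ‖ω y‖ ≤ C)
    (δ : ℝ) (x : (EuclideanSpace ℝ (Fin 3))) :
    biotSavart ω x = (∫ z, cutoff δ z • biotSavartKernel z (ω (x - z))) +
      ∫ y, (1 - cutoff δ (x - y)) • biotSavartKernel (x - y) (ω y) := by
  have hI := integrable_biotSavartKernel_sub_apply hωm hωi hωb x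
  have hmc : Measurable fun y : (EuclideanSpace ℝ (Fin 3)) => cutoff δ (x - y) :=
    ((contDiff_cutoff (n := 0) δ).continuous.comp (continuous_const.sub continuous_id)).measurable
  have i1 : Integrable fun y => cutoff δ (x - y) • biotSavartKernel (x - y) (ω y) := by
    refine hI.norm.mono' (hmc.smul (measurable_biotSavartKernel_sub_apply hωm x)).aestronglyMeasurable
      (Eventually.of_forall fun y => ?_)
    rw [norm_smul]
    exact mul_le_of_le_one_left (norm_nonneg _) (by simpa using abs_cutoff_le_one δ (x - y))
  have i2 : Integrable fun y => (1 - cutoff δ (x - y)) • biotSavartKernel (x - y) (ω y) := by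
    refine hI.norm.mono'
      ((measurable_const.sub hmc).smul (measurable_biotSavartKernel_sub_apply hωm x)).aestronglyMeasurable
      (Eventually.of_forall fun y => ?_)
    rw [norm_smul]
    refine mul_le_of_le_one_left (norm_nonneg _) ?_
    rw [Real.norm_eq_abs, abs_le]
    constructor <;> linarith [cutoff_nonneg δ (x - y), cutoff_le_one δ (x - y)]
  have hsplit : biotSavart ω x = (∫ y, cutoff δ (x - y) • biotSavartKernel (x - y) (ω y)) +
      ∫ y, (1 - cutoff δ (x - y)) • biotSavartKernel (x - y) (ω y) := by
    rw [biotSavart, ← integral_add i1 i2]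
    refine integral_congr_ae (Eventually.of_forall fun y => ?_)
    simp only
    rw [← add_smul, add_sub_cancel, one_smul]
  rw [hsplit]
  congr 1
  have h := integral_sub_left_eq_self
    (fun z => cutoff δ z • biotSavartKernel z (ω (x - z))) volume x
  simp only [sub_sub_cancel] at h
  exact h

/-- The near integrand `z ↦ χ_δ(z) K(z) ω(x − z)` is dominated by the integrable radial majorant
`(4π)⁻¹ C 1_{‖z‖<2δ} ‖z‖⁻²`. [folklore] -/
theorem norm_cutoff_smul_biotSavartKernel_le (hωb : ∀ y, ‖ω y‖ ≤ C) {δ : ℝ} (hδ : 0 < δ)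
    (x z : (EuclideanSpace ℝ (Fin 3))) :
    ‖cutoff δ z • biotSavartKernel z (ω (x - z))‖ ≤
      (4 * Real.pi)⁻¹ * C * nearProfile₂ (2 * δ) ‖z‖ := by
  have hC : 0 ≤ C := (norm_nonneg _).trans (hωb x)
  by_cases hz2 : 2 * δ ≤ ‖z‖
  · rw [cutoff_eq_zero hδ hz2, zero_smul, norm_zero]
    exact mul_nonneg (by positivity) (nearProfile₂_nonneg _ _)
  rw [not_le] at hz2
  rw [norm_smul]
  have h1 : ‖cutoff δ z‖ ≤ 1 := by simpa using abs_cutoff_le_one δ z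
  calc ‖cutoff δ z‖ * ‖biotSavartKernel z (ω (x - z))‖
      ≤ 1 * ((4 * Real.pi * ‖z‖ ^ 2)⁻¹ * ‖ω (x - z)‖) :=
        mul_le_mul h1 (norm_biotSavartKernel_le' _ _) (norm_nonneg _) zero_le_one
    _ ≤ (4 * Real.pi * ‖z‖ ^ 2)⁻¹ * C := by
        rw [one_mul]; exact mul_le_mul_of_nonneg_left (hωb _) (by positivity)
    _ = (4 * Real.pi)⁻¹ * C * nearProfile₂ (2 * δ) ‖z‖ := by
        unfold nearProfile₂
        rw [if_pos hz2, mul_inv]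
        ring

/-- **Uniform bound on the near part**: `‖∫ χ_δ(z) K(z) ω(x − z) dz‖ ≤ 2Cδ` (`∫ 1_{‖z‖<2δ} ‖z‖⁻² = 8πδ`). [folklore] -/
theorem norm_integral_near_le (hωb : ∀ y, ‖ω y‖ ≤ C) {δ : ℝ} (hδ : 0 < δ) (x : (EuclideanSpace ℝ (Fin 3))) :
    ‖∫ z, cutoff δ z • biotSavartKernel z (ω (x - z))‖ ≤ 2 * C * δ := by
  have h := norm_integral_le_of_norm_le
    (((integrable_nearProfile₂_norm (by positivity : 0 < 2 * δ)).const_mul ((4 * Real.pi)⁻¹ * C)))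
    (Eventually.of_forall fun z => norm_cutoff_smul_biotSavartKernel_le hωb hδ x z)
  refine h.trans (le_of_eq ?_)
  rw [integral_const_mul, integral_nearProfile₂_norm_eq (by positivity)]
  field_simp

/-- The far integrand `y ↦ (1 − χ_δ(x − y)) K(x − y) ω(y)` is dominated by `(4πδ²)⁻¹ ‖ω y‖`
(the factor vanishes where `‖x − y‖ ≤ δ`). [folklore] -/
theorem norm_one_sub_cutoff_smul_biotSavartKernel_le (ω : (EuclideanSpace ℝ (Fin 3)) → (EuclideanSpace ℝ (Fin 3))) {δ : ℝ} (hδ : 0 < δ) (x y : (EuclideanSpace ℝ (Fin 3))) :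
    ‖(1 - cutoff δ (x - y)) • biotSavartKernel (x - y) (ω y)‖ ≤
      (4 * Real.pi * δ ^ 2)⁻¹ * ‖ω y‖ := by
  by_cases hxy : ‖x - y‖ ≤ δ
  · rw [cutoff_eq_one hδ hxy, sub_self, zero_smul, norm_zero]
    positivity
  rw [not_le] at hxy
  rw [norm_smul]
  have h1 : ‖1 - cutoff δ (x - y)‖ ≤ 1 := by
    rw [Real.norm_eq_abs, abs_le]
    constructor <;> linarith [cutoff_nonneg δ (x - y), cutoff_le_one δ (x - y)]
  calc ‖1 - cutoff δ (x - y)‖ * ‖biotSavartKernel (x - y) (ω y)‖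
      ≤ 1 * ((4 * Real.pi * ‖x - y‖ ^ 2)⁻¹ * ‖ω y‖) :=
        mul_le_mul h1 (norm_biotSavartKernel_le' _ _) (norm_nonneg _) zero_le_one
    _ ≤ (4 * Real.pi * δ ^ 2)⁻¹ * ‖ω y‖ := by
        rw [one_mul]
        refine mul_le_mul_of_nonneg_right (inv_anti₀ (by positivity) ?_) (norm_nonneg _)
        exact mul_le_mul_of_nonneg_left (pow_le_pow_left₀ hδ.le hxy.le 2) (by positivity)

end Split

/-! ### Continuity and decay at infinity -/

section Continuity

variable {ω : (EuclideanSpace ℝ (Fin 3)) → (EuclideanSpace ℝ (Fin 3))} {C : ℝ}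

/-- **The Biot–Savart velocity of a continuous `L¹ ∩ L^∞` vorticity is continuous**
(Majda–Bertozzi, §2.4.1: `v = K₃ * ω` … "vanishes as `|x| ↗ ∞`"; continuity by dominated
convergence on the near and far parts of the smooth splitting). [folklore] -/
theorem continuous_biotSavart (hωc : Continuous ω) (hωi : Integrable ω) (hωb : ∀ y, ‖ω y‖ ≤ C) :
    Continuous (biotSavart ω) := by
  have hωm : Measurable ω := hωc.measurable
  have hC : 0 ≤ C := (norm_nonneg _).trans (hωb 0)
  -- the near part
  have hnear : Continuous fun x => ∫ z, cutoff 1 z • biotSavartKernel z (ω (x - z)) := by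
    refine continuous_of_dominated (bound := fun z => (4 * Real.pi)⁻¹ * C * nearProfile₂ (2 * 1) ‖z‖)
      (fun x => ?_) (fun x => Eventually.of_forall fun z =>
        norm_cutoff_smul_biotSavartKernel_le hωb one_pos x z)
      ((integrable_nearProfile₂_norm (by norm_num : (0 : ℝ) < 2 * 1)).const_mul _) ?_
    · have hm : Measurable fun z : (EuclideanSpace ℝ (Fin 3)) => (z, ω (x - z)) :=
        measurable_id.prodMk (hωm.comp (continuous_const.sub continuous_id).measurable)
      have h2 := Measurable.comp measurable_biotSavartKernel hm
      exact ((contDiff_cutoff (n := 0) (1 : ℝ)).continuous.measurable.smul h2).aestronglyMeasurable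
    · refine Eventually.of_forall fun z => ?_
      exact ((continuous_biotSavartKernel_right z).comp
        (hωc.comp (continuous_id.sub continuous_const))).const_smul (cutoff 1 z)
  -- the far part
  have hfar : Continuous fun x => ∫ y, (1 - cutoff 1 (x - y)) • biotSavartKernel (x - y) (ω y) := by
    refine continuous_of_dominated (bound := fun y => (4 * Real.pi * (1 : ℝ) ^ 2)⁻¹ * ‖ω y‖)
      (fun x => ?_) (fun x => Eventually.of_forall fun y =>
        norm_one_sub_cutoff_smul_biotSavartKernel_le ω one_pos x y)
      (hωi.norm.const_mul _) ?_
    · have hmc : Measurable fun y : (EuclideanSpace ℝ (Fin 3)) => cutoff 1 (x - y) :=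
        ((contDiff_cutoff (n := 0) (1 : ℝ)).continuous.comp (continuous_const.sub continuous_id)).measurable
      exact ((measurable_const.sub hmc).smul
        (measurable_biotSavartKernel_sub_apply hωm x)).aestronglyMeasurable
    · refine Eventually.of_forall fun y => ?_
      exact (continuous_one_sub_cutoff_smul_biotSavartKernel one_pos (ω y)).comp
        (continuous_id.sub continuous_const)
  have e : biotSavart ω = fun x => (∫ z, cutoff 1 z • biotSavartKernel z (ω (x - z))) +
      ∫ y, (1 - cutoff 1 (x - y)) • biotSavartKernel (x - y) (ω y) :=
    funext fun x => biotSavart_eq_near_add_far hωm hωi hωb 1 x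
  rw [e]
  exact hnear.add hfar

/-- The cocompact filter of `ℝ³` is countably generated (it is `comap ‖·‖ atTop`). [folklore] -/
theorem isCountablyGenerated_cocompact_euclidean :
    (cocompact (EuclideanSpace ℝ (Fin 3))).IsCountablyGenerated := by
  have : (cocompact (EuclideanSpace ℝ (Fin 3))) = comap norm atTop := by
    rw [comap_norm_atTop, Metric.cobounded_eq_cocompact]
  rw [this]
  infer_instance

/-- **The Biot–Savart velocity vanishes at infinity** for `ω ∈ C ∩ L¹ ∩ L^∞` (Majda–Bertozzi,
§2.4.1, proof of Prop. 2.16: "`v` … vanishes as `|x| ↗ ∞`"; p. 80: "in three dimensions `K₃`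
decays like `1/r²`"): the near part at scale `δ` is `≤ 2Cδ` uniformly, the far part tends to
`0` by dominated convergence. [cite: MajdaBertozziCUP2002, §2.4.1 Prop. 2.16 (proof), p. 64 of the held text] -/
theorem tendsto_biotSavart_cocompact (hωc : Continuous ω) (hωi : Integrable ω)
    (hωb : ∀ y, ‖ω y‖ ≤ C) : Tendsto (biotSavart ω) (cocompact (EuclideanSpace ℝ (Fin 3))) (𝓝 0) := by
  have hωm : Measurable ω := hωc.measurable
  have hC : 0 ≤ C := (norm_nonneg _).trans (hωb 0)
  haveI := isCountablyGenerated_cocompact_euclidean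
  rw [Metric.tendsto_nhds]
  intro ε hε
  -- choose the splitting scale
  set δ : ℝ := ε / (4 * C + 4) with hδ_def
  have hδ : 0 < δ := by positivity
  have hnear : ∀ x, ‖∫ z, cutoff δ z • biotSavartKernel z (ω (x - z))‖ ≤ ε / 2 := fun x => by
    refine (norm_integral_near_le hωb hδ x).trans ?_
    rw [hδ_def, div_eq_mul_inv, div_eq_mul_inv]
    have h4 : (4 * C + 4)⁻¹ ≤ (4 * C + 4)⁻¹ := le_rfl
    have : 2 * C * (ε * (4 * C + 4)⁻¹) = ε * ((2 * C) * (4 * C + 4)⁻¹) := by ring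
    rw [this]
    refine mul_le_mul_of_nonneg_left ?_ hε.le
    rw [mul_inv_le_iff₀ (by positivity)]
    linarith
  -- the far part tends to zero
  have hfar : Tendsto (fun x => ∫ y, (1 - cutoff δ (x - y)) • biotSavartKernel (x - y) (ω y))
      (cocompact (EuclideanSpace ℝ (Fin 3))) (𝓝 0) := by
    have h0 : (0 : (EuclideanSpace ℝ (Fin 3))) = ∫ _ : (EuclideanSpace ℝ (Fin 3)), (0 : (EuclideanSpace ℝ (Fin 3))) := by simp
    rw [h0]
    refine tendsto_integral_filter_of_dominated_convergence
      (fun y => (4 * Real.pi * δ ^ 2)⁻¹ * ‖ω y‖) ?_ ?_ (hωi.norm.const_mul _) ?_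
    · refine Eventually.of_forall fun x => ?_
      have hmc : Measurable fun y : (EuclideanSpace ℝ (Fin 3)) => cutoff δ (x - y) :=
        ((contDiff_cutoff (n := 0) δ).continuous.comp (continuous_const.sub continuous_id)).measurable
      exact ((measurable_const.sub hmc).smul
        (measurable_biotSavartKernel_sub_apply hωm x)).aestronglyMeasurable
    · exact Eventually.of_forall fun x => Eventually.of_forall fun y =>
        norm_one_sub_cutoff_smul_biotSavartKernel_le ω hδ x y
    · refine Eventually.of_forall fun y => ?_
      -- `‖(1 − χ) K(x − y) ω(y)‖ ≤ ‖ω y‖/(4π‖x − y‖²) → 0`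
      have hd : Tendsto (fun x : (EuclideanSpace ℝ (Fin 3)) => ‖x - y‖) (cocompact (EuclideanSpace ℝ (Fin 3))) atTop := by
        simpa [dist_eq_norm] using tendsto_dist_right_cocompact_atTop y
      have h1 : Tendsto (fun x : (EuclideanSpace ℝ (Fin 3)) => (4 * Real.pi * ‖x - y‖ ^ 2)⁻¹ * ‖ω y‖) (cocompact (EuclideanSpace ℝ (Fin 3))) (𝓝 0) := by
        have h2 : Tendsto (fun x : (EuclideanSpace ℝ (Fin 3)) => 4 * Real.pi * ‖x - y‖ ^ 2) (cocompact (EuclideanSpace ℝ (Fin 3))) atTop :=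
          (tendsto_pow_atTop two_ne_zero |>.comp hd).const_mul_atTop (by positivity)
        simpa using (tendsto_inv_atTop_zero.comp h2).mul_const ‖ω y‖
      refine squeeze_zero_norm (fun x => ?_) h1
      refine le_trans ?_ (le_of_eq rfl)
      rw [norm_smul]
      have h3 : ‖1 - cutoff δ (x - y)‖ ≤ 1 := by
        rw [Real.norm_eq_abs, abs_le]
        constructor <;> linarith [cutoff_nonneg δ (x - y), cutoff_le_one δ (x - y)]
      calc ‖1 - cutoff δ (x - y)‖ * ‖biotSavartKernel (x - y) (ω y)‖
          ≤ 1 * ((4 * Real.pi * ‖x - y‖ ^ 2)⁻¹ * ‖ω y‖) :=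
            mul_le_mul h3 (norm_biotSavartKernel_le' _ _) (norm_nonneg _) zero_le_one
        _ = (4 * Real.pi * ‖x - y‖ ^ 2)⁻¹ * ‖ω y‖ := one_mul _
  have hfar' : ∀ᶠ x in cocompact (EuclideanSpace ℝ (Fin 3)),
      ‖∫ y, (1 - cutoff δ (x - y)) • biotSavartKernel (x - y) (ω y)‖ < ε / 2 := by
    have := (Metric.tendsto_nhds.1 hfar) (ε / 2) (by positivity)
    filter_upwards [this] with x hx
    simpa [dist_zero_right] using hx
  filter_upwards [hfar'] with x hx
  rw [dist_zero_right, biotSavart_eq_near_add_far hωm hωi hωb δ x]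
  calc ‖(∫ z, cutoff δ z • biotSavartKernel z (ω (x - z))) +
        ∫ y, (1 - cutoff δ (x - y)) • biotSavartKernel (x - y) (ω y)‖
      ≤ ‖∫ z, cutoff δ z • biotSavartKernel z (ω (x - z))‖ +
        ‖∫ y, (1 - cutoff δ (x - y)) • biotSavartKernel (x - y) (ω y)‖ := norm_add_le _ _
    _ < ε / 2 + ε / 2 := add_lt_add_of_le_of_lt (hnear x) hx
    _ = ε := by ring

end Continuity


/-! ### Symmetry of the Biot–Savart operator -/

section Symmetry

variable {ω : (EuclideanSpace ℝ (Fin 3)) → (EuclideanSpace ℝ (Fin 3))} {C : ℝ}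

/-- `⟪a × z, b⟫ = −⟪a, b × z⟫` (both are the triple product `det(a, z, b)`). [folklore] -/
theorem inner_cross_left_eq_neg (a z b : (EuclideanSpace ℝ (Fin 3))) : ⟪cross a z, b⟫ = -⟪a, cross b z⟫ := by
  simp only [cross, PiLp.inner_apply, RCLike.inner_apply, conj_trivial, Fin.sum_univ_three,
    cross_apply, Matrix.cons_val_zero, Matrix.cons_val_one, Matrix.cons_val_two,
    Matrix.head_cons, Matrix.tail_cons]
  ring

/-- **The kernel is symmetric up to reflection**: `⟪K(z) a, b⟫ = ⟪a, K(−z) b⟫` (the matrix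
`K(z)` is antisymmetric and odd in `z`), so that the Biot–Savart operator is symmetric,
`∫ ⟪K₃ * ω, Φ⟫ = ∫ ⟪ω, K₃ * Φ⟫`. [folklore] -/
theorem inner_biotSavartKernel_left (z a b : (EuclideanSpace ℝ (Fin 3))) :
    ⟪biotSavartKernel z a, b⟫ = ⟪a, biotSavartKernel (-z) b⟫ := by
  have hneg : cross b (-z) = -cross b z := by
    rw [← crossCLM_apply, ← crossCLM_apply, map_neg]
  rw [biotSavartKernel, biotSavartKernel, norm_neg, real_inner_smul_left, real_inner_smul_right,
    inner_cross_left_eq_neg, hneg, inner_neg_right]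

/-- **Symmetry of the Biot–Savart operator** (Fubini): for `ω ∈ C ∩ L¹ ∩ L^∞` and a continuous
compactly supported test field `Φ`, `∫ ⟪(K₃ * ω)(x), Φ(x)⟫ dx = ∫ ⟪ω(y), (K₃ * Φ)(y)⟫ dy`. This is
how the weak divergence and the weak curl of `K₃ * ω` are computed for a merely continuous `ω`:
they are read off from `K₃ * Φ` for smooth `Φ`. [folklore] -/
theorem integral_inner_biotSavart_eq (hωc : Continuous ω) (hωi : Integrable ω)
    (hωb : ∀ y, ‖ω y‖ ≤ C) {Φ : (EuclideanSpace ℝ (Fin 3)) → (EuclideanSpace ℝ (Fin 3))} (hΦ : Continuous Φ) (hΦc : HasCompactSupport Φ) :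
    ∫ x, ⟪biotSavart ω x, Φ x⟫ = ∫ y, ⟪ω y, biotSavart Φ y⟫ := by
  have hωm : Measurable ω := hωc.measurable
  have hΦm : Measurable Φ := hΦ.measurable
  obtain ⟨CΦ, hCΦ⟩ := hΦ.bounded_above_of_compact_support hΦc
  have hΦi : Integrable Φ := hΦ.integrable_of_hasCompactSupport hΦc
  set B : ℝ := C + (4 * Real.pi)⁻¹ * ∫ y, ‖ω y‖ with hB
  -- the integrand on the product space
  set f : (EuclideanSpace ℝ (Fin 3)) → (EuclideanSpace ℝ (Fin 3)) → ℝ := fun x y => ⟪biotSavartKernel (x - y) (ω y), Φ x⟫ with hf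
  have hFm : Measurable (uncurry f) := by
    have h1 : Measurable fun p : (EuclideanSpace ℝ (Fin 3)) × (EuclideanSpace ℝ (Fin 3)) => (p.1 - p.2, ω p.2) :=
      (measurable_fst.sub measurable_snd).prodMk (hωm.comp measurable_snd)
    have h2 := Measurable.comp measurable_biotSavartKernel h1
    have h3 : Measurable fun p : (EuclideanSpace ℝ (Fin 3)) × (EuclideanSpace ℝ (Fin 3)) => Φ p.1 := hΦm.comp measurable_fst
    exact h2.inner h3
  -- sections in `y` are integrable, with `L¹` norm at most `‖Φ x‖ B`
  have hsec : ∀ x, Integrable (f x) := fun x => by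
    refine ((integrable_biotSavartKernel_sub_apply hωm hωi hωb x).norm.mul_const ‖Φ x‖).mono'
      ((measurable_biotSavartKernel_sub_apply hωm x).inner measurable_const).aestronglyMeasurable
      (Eventually.of_forall fun y => ?_)
    exact norm_inner_le_norm _ _
  have hsecL1 : ∀ x, ∫ y, ‖f x y‖ ≤ ‖Φ x‖ * B := fun x => by
    calc ∫ y, ‖f x y‖ ≤ ∫ y, ‖biotSavartKernel (x - y) (ω y)‖ * ‖Φ x‖ :=
          integral_mono_of_nonneg (Eventually.of_forall fun y => norm_nonneg _)
            ((integrable_biotSavartKernel_sub_apply hωm hωi hωb x).norm.mul_const _)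
            (Eventually.of_forall fun y => norm_inner_le_norm _ _)
      _ = (∫ y, ‖biotSavartKernel (x - y) (ω y)‖) * ‖Φ x‖ := integral_mul_const _ _
      _ ≤ B * ‖Φ x‖ := mul_le_mul_of_nonneg_right
          (integral_norm_biotSavartKernel_sub_apply_le hωi hωb x) (norm_nonneg _)
      _ = ‖Φ x‖ * B := mul_comm _ _
  have hF : Integrable (uncurry f) (volume.prod volume) := by
    refine (integrable_prod_iff hFm.aestronglyMeasurable).2 ⟨Eventually.of_forall hsec, ?_⟩
    refine (hΦi.norm.mul_const B).mono' hFm.aestronglyMeasurable.norm.integral_prod_right'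
      (Eventually.of_forall fun x => ?_)
    rw [Real.norm_of_nonneg (integral_nonneg fun y => norm_nonneg _)]
    exact hsecL1 x
  -- Fubini
  have hswap := integral_integral_swap hF
  -- identify the two sides
  have hL : ∀ x, ⟪biotSavart ω x, Φ x⟫ = ∫ y, f x y := fun x => by
    have e : ∀ y, f x y = ⟪Φ x, biotSavartKernel (x - y) (ω y)⟫ := fun y => real_inner_comm _ _
    simp_rw [e]
    rw [integral_inner (integrable_biotSavartKernel_sub_apply hωm hωi hωb x) (Φ x), biotSavart,
      real_inner_comm]
  have hR : ∀ y, ∫ x, f x y = ⟪ω y, biotSavart Φ y⟫ := fun y => by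
    have e : ∀ x, f x y = ⟪ω y, biotSavartKernel (y - x) (Φ x)⟫ := fun x => by
      simp only [hf]
      rw [inner_biotSavartKernel_left, neg_sub]
    simp_rw [e]
    rw [integral_inner (integrable_biotSavartKernel_sub_apply hΦm hΦi hCΦ y) (ω y), biotSavart]
  simp_rw [hL, hswap, hR]

end Symmetry

end Literature.Analysis.FluidPDE
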